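import Literature.Geometry.Riemannian.PinchingEstimatesAlgebra
import Literature.Geometry.Riemannian.PinchingSetsConvexity
import Literature.Geometry.Riemannian.PinchingEstimatesConstraints
import HarnessLib

/-!
# Hamilton's complete system of pinching inequalities as one time-dependent family of sets
(topic `Geometry/Riemannian`)

Part of the decomposition of `Literature.Geometry.Riemannian.hamilton_chenZhu_pinching`
(`PinchingEstimates.lean`; Chen–Zhu 2006, Lemma 2.1 = Hamilton 1997, Thms. B1.1 + B2.3). The
maximum principle `hamilton_maximumPrinciple_curvatureODE` (`HamiltonCurvatureODE.lean`) is
applied, as in Hamilton's proof of Thm. 1.1 (1997, pp. 7–21), to the *complete* system of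
pinching inequalities at once: the phase-space constraints `A, C` symmetric and `tr A = tr C`
(`PinchingEstimatesConstraints.lean`) and the sets of Thms. 1.2, 1.3, 1.4, 1.6, 1.7, 1.9, 2.1, 2.3
(`PinchingEstimatesODE.lean`). This file defines that family (`HamiltonODE.pinchingFamily`, a
real definition) and PROVES the structural hypotheses of the maximum principle for it — closed,
closed space-time track, symmetric under `B ↦ -B`, convex (from `PinchingSetsConvexity.lean`) —
and the read-out of Chen–Zhu's (2.1)–(2.2) from membership (Cors. 1.5, 1.8 of
`PinchingEstimatesAlgebra.lean`). Its forward invariance (from Hamilton's ODE theorems) and the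
assembly are in `PinchingEstimatesAssembly.lean`.

## References

* R. S. Hamilton, *Four-manifolds with positive isotropic curvature*, Comm. Anal. Geom. 5 (1997)
  1–92, §2, Thms. 1.2–2.3 and the proof of Thm. 1.1 (pp. 7–21). [Hamilton1997]
* B.-L. Chen, X.-P. Zhu, J. Differential Geom. 74 (2006), §2, Lemma 2.1. [ChenZhu2006]
-/

noncomputable section

open Set Real
open scoped Matrix Topology

namespace Literature.Geometry.Riemannian

namespace HamiltonODE

/-- **Hamilton's complete system of pinching inequalities** (1997, Thms. 1.2, 1.3, 1.4, 1.6, 1.7,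
1.9, 2.1, 2.3, on the phase space `A, C` symmetric with the Bianchi constraint `tr A = tr C`) as a
time-dependent family of sets of block triples, with constants `m, Λ, Φ, ρ₁, ρ, Ψ, K, L, P, Q`
(`H = L/2` in Thm. 1.9, as on p. 20). [cite: Hamilton1997, §2, Thms. 1.2–2.3 (pp. 7–20)] -/
def pinchingFamily (m Λ Φ ρ₁ ρ Ψ K L P Q : ℝ) (t : ℝ) : Set Blocks :=
  {p | p.1.IsSymm ∧ p.2.2.IsSymm} ∩
    {p | p.1.TwoSmallestEigenvaluesSumGE m} ∩ {p | p.2.2.TwoSmallestEigenvaluesSumGE m} ∩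
    {p | SingularValuesSumSqLE p Λ} ∩ {p | p.1.trace = p.2.2.trace} ∩
    {p | p.1.TwoLargestEigenvaluesSumLE Φ ∧ p.2.2.TwoLargestEigenvaluesSumLE Φ} ∩
    {p | p.1.SmallestEigenvalueAddNonneg ρ₁} ∩ {p | p.2.2.SmallestEigenvalueAddNonneg ρ₁} ∩
    {p | p.1.LargestLESmallestAdd Ψ ρ ∧ p.2.2.LargestLESmallestAdd Ψ ρ} ∩
    {p | SingularValueLEExp p (L / 2) P ρ t} ∩ {p | ImprovedPinching p K} ∩
    {p | ImprovedPinchingQ p ρ L P Q t}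

variable {m Λ Φ ρ₁ ρ Ψ K L P Q : ℝ}

/-- Each set of the family is closed (`Q > 0`). [folklore] -/
theorem isClosed_pinchingFamily (hQ : 0 < Q) (t : ℝ) :
    IsClosed (pinchingFamily m Λ Φ ρ₁ ρ Ψ K L P Q t) := by
  refine ((((((((((isClosed_isSymm.inter (isClosed_twoSmallestA m)).inter
    (isClosed_twoSmallestC m)).inter
    (isClosed_singularValuesSumSqLE Λ)).inter isClosed_trace_eq).inter
    ((isClosed_twoLargestA Φ).inter (isClosed_twoLargestC Φ))).inter
    (isClosed_smallestAddNonnegA ρ₁)).inter (isClosed_smallestAddNonnegC ρ₁)).inter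
    ((isClosed_largestLESmallestAddA Ψ ρ).inter (isClosed_largestLESmallestAddC Ψ ρ))).inter
    (isClosed_singularValueLEExp _ P ρ t)).inter (isClosed_improvedPinching K)).inter
    (isClosed_improvedPinchingQ hQ ρ L P t)

/-- The space-time track of the family over `t ≥ 0` is closed (`Q > 0`). [folklore] -/
theorem isClosed_pinchingFamily_track (hQ : 0 < Q) :
    IsClosed {q : ℝ × Blocks | 0 ≤ q.1 ∧ q.2 ∈ pinchingFamily m Λ Φ ρ₁ ρ Ψ K L P Q q.1} := by
  simp only [pinchingFamily, mem_inter_iff, mem_setOf_eq, setOf_and]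
  refine (isClosed_le continuous_const continuous_fst).inter ?_
  refine (((((((((((?_ : IsClosed (_ ∩ _)).inter ?_).inter ?_).inter ?_).inter ?_).inter
    (?_ : IsClosed (_ ∩ _))).inter ?_).inter ?_).inter (?_ : IsClosed (_ ∩ _))).inter ?_).inter
    ?_).inter ?_
  · exact ((isClosed_eq continuous_snd.fst.matrix_transpose continuous_snd.fst)).inter
      (isClosed_eq continuous_snd.snd.snd.matrix_transpose continuous_snd.snd.snd)
  · exact (isClosed_twoSmallestA m).preimage continuous_snd
  · exact (isClosed_twoSmallestC m).preimage continuous_snd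
  · exact (isClosed_singularValuesSumSqLE Λ).preimage continuous_snd
  · exact isClosed_trace_eq.preimage continuous_snd
  · exact ((isClosed_twoLargestA Φ).preimage continuous_snd).inter
      ((isClosed_twoLargestC Φ).preimage continuous_snd)
  · exact (isClosed_smallestAddNonnegA ρ₁).preimage continuous_snd
  · exact (isClosed_smallestAddNonnegC ρ₁).preimage continuous_snd
  · exact ((isClosed_largestLESmallestAddA Ψ ρ).preimage continuous_snd).inter
      ((isClosed_largestLESmallestAddC Ψ ρ).preimage continuous_snd)
  · exact isClosed_singularValueLEExp_track _ P ρ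
  · exact (isClosed_improvedPinching K).preimage continuous_snd
  · exact isClosed_improvedPinchingQ_track hQ ρ L P

/-- Each set of the family is symmetric under `B ↦ -B`. [folklore] -/
theorem reflectB_mem_pinchingFamily {t : ℝ} {p : Blocks}
    (hp : p ∈ pinchingFamily m Λ Φ ρ₁ ρ Ψ K L P Q t) :
    reflectB p ∈ pinchingFamily m Λ Φ ρ₁ ρ Ψ K L P Q t := by
  obtain ⟨⟨⟨⟨⟨⟨⟨⟨⟨⟨⟨h0, h1⟩, h2⟩, h3⟩, h4⟩, h5⟩, h6⟩, h7⟩, h8⟩, h9⟩, h10⟩, h11⟩ := hp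
  exact ⟨⟨⟨⟨⟨⟨⟨⟨⟨⟨⟨h0, h1⟩, h2⟩, h3.reflectB⟩, h4⟩, h5⟩, h6⟩, h7⟩, h8⟩, h9.reflectB⟩,
    h10.reflectB⟩, h11.reflectB⟩

/-- Each set of the family is convex, for `m, Λ, K, L ≥ 0`, `ρ₁ ≤ ρ`, `Q ≥ 2` (Hamilton's
convexity statements, `PinchingSetsConvexity.lean`). [cite: Hamilton1997, §2, pp. 7–17 (convexity of each pinching set)] -/
theorem convex_pinchingFamily (hm : 0 ≤ m) (hΛ : 0 ≤ Λ) (hρ : ρ₁ ≤ ρ) (hK : 0 ≤ K) (hL : 0 ≤ L)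
    (hQ : 2 ≤ Q) (t : ℝ) : Convex ℝ (pinchingFamily m Λ Φ ρ₁ ρ Ψ K L P Q t) := by
  intro x hx y hy a b ha hb hab
  obtain ⟨⟨⟨⟨⟨⟨⟨⟨⟨⟨⟨x0, x1⟩, x2⟩, x3⟩, x4⟩, x5⟩, x6⟩, x7⟩, x8⟩, x9⟩, x10⟩, x11⟩ := hx
  obtain ⟨⟨⟨⟨⟨⟨⟨⟨⟨⟨⟨y0, y1⟩, y2⟩, y3⟩, y4⟩, y5⟩, y6⟩, y7⟩, y8⟩, y9⟩, y10⟩, y11⟩ := hy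
  have x6' : x.1.SmallestEigenvalueAddNonneg ρ := fun w hw ↦ (x6 w hw).trans (by linarith)
  have x7' : x.2.2.SmallestEigenvalueAddNonneg ρ := fun w hw ↦ (x7 w hw).trans (by linarith)
  have y6' : y.1.SmallestEigenvalueAddNonneg ρ := fun w hw ↦ (y6 w hw).trans (by linarith)
  have y7' : y.2.2.SmallestEigenvalueAddNonneg ρ := fun w hw ↦ (y7 w hw).trans (by linarith)
  refine ⟨⟨⟨⟨⟨⟨⟨⟨⟨⟨⟨isSymm_combo x0 y0 a b, x1.combo y1 ha hb hab⟩, x2.combo y2 ha hb hab⟩,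
    x3.combo hm hΛ x1 x2 y1 y2 y3 ha hb⟩, trace_eq_combo x4 y4 a b⟩,
    ⟨x5.1.combo y5.1 ha hb, x5.2.combo y5.2 ha hb⟩⟩, x6.combo y6 ha hb hab⟩,
    x7.combo y7 ha hb hab⟩, ⟨x8.1.combo y8.1 ha hb hab, x8.2.combo y8.2 ha hb hab⟩⟩,
    x9.combo (by linarith) x6' x7' y6' y7' y9 ha hb hab⟩,
    x10.combo hm hK x1 x2 y1 y2 y10 ha hb hab⟩,
    x11.combo hL hQ x6' x7' y6' y7' y11 ha hb hab⟩

/-- From membership in the family: Cor. 1.5's bounds with `Ξ = Φ + 1` and Chen–Zhu's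
(2.1)–(2.2) with `Ω = (Φ + 1)(Ψ + 1)` (Cors. 1.5 and 1.8, proved), provided `m, Λ > 0`,
`Φ ≥ Λ + 1`, `0 ≤ ρ₁ < ρ`. [cite: Hamilton1997, §2.1, Cors. 1.5 and 1.8 (pp. 9–12)] -/
theorem maxLE_and_pinchedBy_of_mem {t : ℝ} {p : Blocks} (hm : 0 < m) (hΛ : 0 < Λ)
    (hΦ : Λ + 1 ≤ Φ) (hρ₁ : 0 ≤ ρ₁) (hρ : ρ₁ < ρ)
    (hp : p ∈ pinchingFamily m Λ Φ ρ₁ ρ Ψ K L P Q t) :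
    MaxLEPairSum p (Φ + 1) ∧ Matrix.PinchedBy p.1 p.2.1 p.2.2 ρ ((Φ + 1) * (Ψ + 1)) := by
  obtain ⟨⟨⟨⟨⟨⟨⟨⟨⟨⟨⟨-, h1⟩, h2⟩, h3⟩, h4⟩, h5⟩, h6⟩, h7⟩, h8⟩, -⟩, -⟩, -⟩ := hp
  have hMax := maxLEPairSum_of_estimates hm hΛ hΦ h1 h2 h3 h5.1 h5.2 h4
  refine ⟨hMax, pinchedBy_of_estimates (by linarith) (by linarith) hMax h8.1 h8.2 fun w hw ↦ ?_⟩
  exact ⟨by linarith [h6 w hw], by linarith [h7 w hw]⟩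

end HamiltonODE

/-- `Matrix.ImprovedPinchingAt` is monotone in `Λ` (its right-hand side is
`(1 + Λ e^{Pt}/max{·, 2}) √·` with non-negative factors). [folklore] -/
theorem _root_.Matrix.ImprovedPinchingAt.mono {A B C : Matrix (Fin 3) (Fin 3) ℝ}
    {ρ Λ Λ' P t : ℝ} (h : Matrix.ImprovedPinchingAt A B C ρ Λ P t) (hΛ : Λ ≤ Λ') :
    Matrix.ImprovedPinchingAt A B C ρ Λ' P t := by
  intro u v w w' hu hv hw hw'
  refine (h u v w w' hu hv hw hw').trans (mul_le_mul_of_nonneg_right ?_ (sqrt_nonneg _))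
  have h2 : (0 : ℝ) < max (log (sqrt ((w ⬝ᵥ (A *ᵥ w) + ρ) * (w' ⬝ᵥ (C *ᵥ w') + ρ)))) 2 :=
    lt_max_of_lt_right two_pos
  have := (exp_pos (P * t)).le
  gcongr

end Literature.Geometry.Riemannian

end
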